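import Literature.LinearAlgebra.Matrix.IntegerEigenvaluesUpperTriangular
import HarnessLib

/-!
# When is an integer matrix with `n` different integer eigenvalues `GLₙ(ℤ)`-conjugate to the diagonal matrix?
# The class of the maximal order `Λ_max = ℤe₁ + ⋯ + ℤeₙ` (class number `1`) and its `2ⁿ` units
# (Hertling–Larabi 2026b §9.1 with Theorem 6.3), in matrix language: integrality of the Lagrange idempotents

[topic LinearAlgebra/Matrix] Lane `lit-hodgefound` (Track 2 foundations library), seat p19 generation 40, row g40-#7.
Sequel of `IntegerEigenvaluesUpperTriangular` (g40-#5: `χ_N = ∏ᵢ (t − λᵢ)` ⟹ `N` is `GLₙ(ℤ)`-conjugate to an upper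
triangular integer matrix with diagonal `λ`), which is REUSED for the non-trivial direction.  THEOREMS ONLY: no
definition, no instance, no notation, no named fact (D-0026, net Literature debt `0`), no `sorry`.

## Source, VERBATIM

C. Hertling, K. Larabi, *Conjugacy classes of regular integer matrices*, arXiv:2602.15748 (2026)
[HertlingLarabi2026b], held `paper:arxiv-2602.15748`.
* §6 Thm. 6.3, chunk p0012: the `GL_n(ℤ)`-conjugacy classes of regular integer matrices with characteristic
  polynomial `f` correspond 1:1 to `{[L]_ε | L ∈ 𝓛(A_f), 𝒪(L) ⊃ Λ_f}`, `A_f = ℚ[t]/(f)`, `Λ_f = ℤ[t]/(f)`; a `ℤ`-basis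
  `𝓑` of `L` gives the matrix `M` with `[t]·𝓑 = 𝓑·M`, and `P ∈ GL_n(ℤ)` changes the basis.
* §9.1, chunk p0027 (`f` with `n` different integer roots `λ₁, …, λₙ`, `A = ℚe₁ + ⋯ + ℚeₙ`, `eᵢeⱼ = δᵢⱼeᵢ`,
  `[t] = λ₁e₁ + ⋯ + λₙeₙ`): «The maximal order `Λ_max` in `A` is by the proof of Theorem 4.8
  `Λ_max = ℤe₁ + ... + ℤeₙ`.  Each `Λ_max`-ideal `L ∈ 𝓛(A)` splits as `L = ⊕ᵢ L ∩ ℚeᵢ = ⊕ᵢ ℤβᵢᵢeᵢ` for some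
  `β₁₁, ..., βₙₙ ∈ ℚ_{>0}`, so `L = (Σᵢ βᵢᵢeᵢ)·Λ_max ∈ [Λ_max]_ε`, so `G([Λ_max]_ε) = {[Λ_max]_ε}`, so the class number
  of `A` is `|G([Λ_max]_ε)| = 1.» and «The group of units `Λ^{unit}` of an order `Λ` is quite different from the
  case of algebraic number fields. It is finite, namely `Λ_max^{unit} = {Σᵢ εᵢeᵢ | ε₁, ..., εₙ ∈ {±1}}`, so
  `|Λ_max^{unit}| = 2ⁿ`».

Matrix dictionary used below (Thm. 6.3): the lattice `L = ℤⁿ` on which `[t]` acts by `N`; `eᵢ` acts on `ℚⁿ` by the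
LAGRANGE IDEMPOTENT `eᵢ(N) = qᵢ(N)/cᵢ`, `qᵢ(t) = ∏_{j≠i} (t − λⱼ) ∈ ℤ[t]`, `cᵢ = qᵢ(λᵢ) = ∏_{j≠i} (λᵢ − λⱼ) ≠ 0`;
`𝒪(L) = Λ_max` iff every `eᵢ(N)` is an integer matrix iff `cᵢ` divides all entries of `qᵢ(N)`; and `[Λ_max]_ε` is the
class of `diag(λ₁, …, λₙ)` (the matrix of `[t]` in the basis `e₁, …, eₙ` of `Λ_max`); the units `Σεᵢeᵢ` of `Λ_max`
are the diagonal sign matrices, i.e. the centraliser of `diag(λ)` in `GLₙ(ℤ)`.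

## What is proved (`N : Matrix (Fin n) (Fin n) ℤ`, `l : Fin n → ℤ` injective, `qᵢ(N) = aeval N (∏_{j≠i} (X − C (l j)))`)

* §1 (private) polynomial calculus: `P N = N′ P ⟹ P q(N) = q(N′) P`; `q(T)` is upper triangular with diagonal
  `q(Tᵢᵢ)` for upper triangular `T`; `q(diag d) = diag (q ∘ d)`; `qᵢ(λ_k) = cᵢ·[k = i]`; `(N − λᵢ)qᵢ(N) = 0`.
* §2 `dvd_aeval_of_conj_diagonal`: if `PN = diag(λ)P` with `P ∈ GLₙ(ℤ)` then `cᵢ ∣ qᵢ(N)_{km}` for all `i, k, m`.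
* §3 **`exists_conj_diagonal_of_dvd_aeval`**: conversely, if `χ_N = ∏ᵢ (t − λᵢ)` and `cᵢ ∣ qᵢ(N)_{km}` for all
  `i, k, m`, then `PN = diag(λ)P` for some `P ∈ GLₙ(ℤ)` (triangularise by g40-#5, then the normalised columns
  `qᵢ(T)eᵢ/cᵢ` form a unitriangular integer matrix of eigenvectors); **`conj_diagonal_iff_dvd_aeval`** (the criterion).
* §4 `comm_diagonal_iff`, `isUnit_det_and_comm_diagonal_iff` (the centraliser of `diag(λ)` in `GLₙ(ℤ)` is the group of
  the `2ⁿ` diagonal sign matrices), `natCard_centralizer_diagonal` (`= 2ⁿ`).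
-/

open Matrix Polynomial

namespace Literature.LinearAlgebra.Matrix.IntegerMatrixDiagonalizableOverZ

open Literature.LinearAlgebra.Matrix.IntegerEigenvaluesTriangular (exists_conj_upperTriangular
  charpoly_of_blockTriangular)

variable {n : ℕ}

/-! ## §1 Polynomial calculus (private) -/

/-- Intertwining passes to powers. [folklore] -/
private theorem conj_pow {N N' P : Matrix (Fin n) (Fin n) ℤ} (h : P * N = N' * P) (k : ℕ) :
    P * N ^ k = N' ^ k * P := by
  induction k with
  | zero => rw [pow_zero, pow_zero, mul_one, one_mul]
  | succ k ih => rw [pow_succ, ← mul_assoc, ih, mul_assoc, h, ← mul_assoc, ← pow_succ]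

/-- Intertwining passes to polynomials: `PN = N′P ⟹ P·q(N) = q(N′)·P`. [folklore] -/
private theorem conj_aeval {N N' P : Matrix (Fin n) (Fin n) ℤ} (h : P * N = N' * P) (q : ℤ[X]) :
    P * aeval N q = aeval N' q * P := by
  induction q using Polynomial.induction_on' with
  | add p q hp hq => rw [map_add, map_add, mul_add, add_mul, hp, hq]
  | monomial k c =>
    rw [← C_mul_X_pow_eq_monomial, map_mul, map_pow, aeval_C, aeval_X, map_mul, map_pow, aeval_C, aeval_X,
      Algebra.algebraMap_eq_smul_one, smul_mul_assoc, smul_mul_assoc, one_mul, one_mul, Matrix.mul_smul,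
      Matrix.smul_mul, conj_pow h]

/-- The diagonal of a product of upper triangular matrices. [folklore] -/
private theorem mul_apply_diag {A B : Matrix (Fin n) (Fin n) ℤ} (hA : A.BlockTriangular id)
    (hB : B.BlockTriangular id) (k : Fin n) : (A * B) k k = A k k * B k k := by
  rw [Matrix.mul_apply]
  refine Finset.sum_eq_single k (fun m _ hm => ?_) (fun h => absurd (Finset.mem_univ k) h)
  rcases lt_or_gt_of_ne hm with h | h
  · rw [hA h, zero_mul]
  · rw [hB h, mul_zero]

/-- `q(T)` is upper triangular with diagonal entries `q(T_kk)` for upper triangular `T`. [folklore] -/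
private theorem aeval_upper {T : Matrix (Fin n) (Fin n) ℤ} (hT : T.BlockTriangular id) (q : ℤ[X]) :
    (aeval T q).BlockTriangular id ∧ ∀ k, (aeval T q) k k = q.eval (T k k) := by
  induction q using Polynomial.induction_on' with
  | add p q hp hq =>
    refine ⟨by rw [map_add]; exact hp.1.add hq.1, fun k => ?_⟩
    rw [map_add, Matrix.add_apply, hp.2, hq.2, eval_add]
  | monomial m c =>
    have hpow : ∀ j : ℕ, (T ^ j).BlockTriangular id ∧ ∀ k, (T ^ j) k k = T k k ^ j := by
      intro j
      induction j with
      | zero => exact ⟨by rw [pow_zero]; exact blockTriangular_one, fun k => by rw [pow_zero, pow_zero, one_apply_eq]⟩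
      | succ j ih =>
        refine ⟨by rw [pow_succ]; exact ih.1.mul hT, fun k => ?_⟩
        rw [pow_succ, mul_apply_diag ih.1 hT, ih.2, pow_succ]
    have e : aeval T (monomial m c) = c • T ^ m := by
      rw [← C_mul_X_pow_eq_monomial, map_mul, map_pow, aeval_C, aeval_X, Algebra.algebraMap_eq_smul_one,
        smul_mul_assoc, one_mul]
    refine ⟨?_, fun k => ?_⟩
    · rw [e]; exact fun i j hij => by rw [Matrix.smul_apply, (hpow m).1 hij, smul_zero]
    · rw [e, Matrix.smul_apply, (hpow m).2, smul_eq_mul, eval_monomial]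

/-- `q(diag d) = diag (k ↦ q(d_k))`. [folklore] -/
private theorem aeval_diagonal (d : Fin n → ℤ) (q : ℤ[X]) :
    aeval (diagonal d) q = diagonal fun k => q.eval (d k) := by
  induction q using Polynomial.induction_on' with
  | add p q hp hq =>
    rw [map_add, hp, hq, diagonal_add]
    exact congr_arg _ (funext fun k => by rw [eval_add])
  | monomial m c =>
    rw [← C_mul_X_pow_eq_monomial, map_mul, map_pow, aeval_C, aeval_X, Algebra.algebraMap_eq_smul_one,
      smul_mul_assoc, one_mul, diagonal_pow, ← diagonal_smul]
    exact congr_arg _ (funext fun k => by rw [Pi.smul_apply, Pi.pow_apply, smul_eq_mul, eval_mul, eval_C,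
      eval_pow, eval_X])

/-- The Lagrange numerator `qᵢ = ∏_{j≠i} (t − λⱼ)` at `λ_k`: `cᵢ` for `k = i`, `0` otherwise. [folklore] -/
private theorem eval_lagrange (l : Fin n → ℤ) (i k : Fin n) :
    (∏ j ∈ Finset.univ.erase i, (X - C (l j))).eval (l k) =
      if k = i then ∏ j ∈ Finset.univ.erase i, (l i - l j) else 0 := by
  rw [eval_prod]
  split_ifs with hk
  · subst hk
    exact Finset.prod_congr rfl fun j _ => by rw [eval_sub, eval_X, eval_C]
  · exact Finset.prod_eq_zero (Finset.mem_erase.2 ⟨hk, Finset.mem_univ k⟩) (by rw [eval_sub, eval_X, eval_C, sub_self])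

/-- `cᵢ = ∏_{j≠i} (λᵢ − λⱼ) ≠ 0` for pairwise different `λ`. [folklore] -/
private theorem lagrange_ne_zero {l : Fin n → ℤ} (hl : Function.Injective l) (i : Fin n) :
    ∏ j ∈ Finset.univ.erase i, (l i - l j) ≠ 0 :=
  Finset.prod_ne_zero_iff.2 fun _ hj => sub_ne_zero.2 fun e => (Finset.ne_of_mem_erase hj) (hl e).symm

/-- Cayley–Hamilton: `(N − λᵢ)·qᵢ(N) = χ_N(N) = 0` when `χ_N = ∏ⱼ (t − λⱼ)`. [folklore] -/
private theorem sub_mul_aeval_lagrange {N : Matrix (Fin n) (Fin n) ℤ} {l : Fin n → ℤ}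
    (h : N.charpoly = ∏ i, (X - C (l i))) (i : Fin n) :
    (N - l i • (1 : Matrix (Fin n) (Fin n) ℤ)) * aeval N (∏ j ∈ Finset.univ.erase i, (X - C (l j))) = 0 := by
  have e : aeval N (X - C (l i)) = N - l i • (1 : Matrix (Fin n) (Fin n) ℤ) := by
    rw [map_sub, aeval_X, aeval_C, Algebra.algebraMap_eq_smul_one]
  have hprod : (X - C (l i)) * ∏ j ∈ Finset.univ.erase i, (X - C (l j)) = ∏ j, (X - C (l j)) :=
    Finset.mul_prod_erase (s := Finset.univ) (f := fun j => X - C (l j)) (Finset.mem_univ i)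
  rw [← e, ← map_mul, hprod, ← h]
  exact Matrix.aeval_self_charpoly N

/-- A matrix all of whose entries are divisible by `c` is `c` times an integer matrix. [folklore] -/
private theorem exists_eq_smul_of_dvd {A : Matrix (Fin n) (Fin n) ℤ} {c : ℤ} (h : ∀ k m, c ∣ A k m) :
    ∃ A' : Matrix (Fin n) (Fin n) ℤ, A = c • A' := by
  refine ⟨Matrix.of fun k m => A k m / c, ?_⟩
  ext k m
  rw [Matrix.smul_apply, Matrix.of_apply, smul_eq_mul, Int.mul_ediv_cancel' (h k m)]

/-! ## §2 The easy direction: conjugates of `diag(λ)` have integral Lagrange idempotents -/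

/-- **If `PN = diag(λ)P` with `P ∈ GLₙ(ℤ)`, then `cᵢ = ∏_{j≠i} (λᵢ − λⱼ)` divides every entry of
`qᵢ(N) = ∏_{j≠i} (N − λⱼ)`** (`eᵢ = qᵢ([t])/cᵢ ∈ Λ_max` acts integrally on every lattice in `[Λ_max]_ε`).
[cite: HertlingLarabi2026b, §9.1 («`Λ_max = ℤe₁ + ... + ℤeₙ`»), chunk p0027, with §6 Thm. 6.3, chunk p0012] -/
theorem dvd_aeval_of_conj_diagonal {N P : Matrix (Fin n) (Fin n) ℤ} {l : Fin n → ℤ} (hP : IsUnit P.det)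
    (h : P * N = diagonal l * P) (i k m : Fin n) :
    (∏ j ∈ Finset.univ.erase i, (l i - l j)) ∣
      (aeval N (∏ j ∈ Finset.univ.erase i, (X - C (l j)))) k m := by
  set q : ℤ[X] := ∏ j ∈ Finset.univ.erase i, (X - C (l j)) with hq
  set c : ℤ := ∏ j ∈ Finset.univ.erase i, (l i - l j) with hc
  have hD : aeval (diagonal l) q = c • diagonal (fun k : Fin n => if k = i then (1 : ℤ) else 0) := by
    rw [aeval_diagonal, ← diagonal_smul]
    refine congr_arg _ (funext fun k => ?_)
    rw [hq, eval_lagrange, Pi.smul_apply, smul_eq_mul, mul_ite, mul_one, mul_zero]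
  have e : aeval N q = c • (P⁻¹ * (diagonal (fun k : Fin n => if k = i then (1 : ℤ) else 0) * P)) := by
    calc aeval N q = P⁻¹ * (P * aeval N q) := by
          rw [← Matrix.mul_assoc, Matrix.nonsing_inv_mul P hP, Matrix.one_mul]
      _ = P⁻¹ * (aeval (diagonal l) q * P) := by rw [conj_aeval h]
      _ = _ := by rw [hD, Matrix.smul_mul, Matrix.mul_smul]
  rw [e, Matrix.smul_apply, smul_eq_mul]
  exact Dvd.intro _ rfl

/-! ## §3 The criterion: integral Lagrange idempotents ⟹ conjugate to `diag(λ)` -/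

/-- **`χ_N = ∏ᵢ (t − λᵢ)` with pairwise different `λᵢ ∈ ℤ`, and `cᵢ ∣ qᵢ(N)` entrywise for every `i` ⟹ `N` is
`GLₙ(ℤ)`-conjugate to `diag(λ₁, …, λₙ)`** — the matrix form of «each `Λ_max`-ideal `L` splits as `⊕ᵢ L ∩ ℚeᵢ` … so
`L ∈ [Λ_max]_ε` … the class number of `A` is `1`»: the hypothesis says that the idempotents `eᵢ = qᵢ([t])/cᵢ`, hence
`Λ_max`, act on `L = ℤⁿ`.  Proof here: triangularise (`IntegerEigenvaluesTriangular.exists_conj_upperTriangular`);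
then the `i`-th column of `qᵢ(T)/cᵢ` is an integral `λᵢ`-eigenvector with `i`-th entry `1` and zero entries below,
so these columns form a unitriangular `V ∈ SLₙ(ℤ)` with `TV = V·diag(λ)`.
[cite: HertlingLarabi2026b, §9.1 («the class number of `A` is `|G([Λ_max]_ε)| = 1`»), chunk p0027, with §6 Thm. 6.3, chunk p0012] -/
theorem exists_conj_diagonal_of_dvd_aeval {N : Matrix (Fin n) (Fin n) ℤ} {l : Fin n → ℤ}
    (hl : Function.Injective l) (h : N.charpoly = ∏ i, (X - C (l i)))
    (hdvd : ∀ i k m : Fin n, (∏ j ∈ Finset.univ.erase i, (l i - l j)) ∣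
      (aeval N (∏ j ∈ Finset.univ.erase i, (X - C (l j)))) k m) :
    ∃ P : Matrix (Fin n) (Fin n) ℤ, IsUnit P.det ∧ P * N = diagonal l * P := by
  obtain ⟨P₀, T, hP₀, hP₀N, hT, hTdiag⟩ := exists_conj_upperTriangular h
  have hTχ : T.charpoly = ∏ i, (X - C (l i)) := by
    rw [charpoly_of_blockTriangular hT]
    exact Finset.prod_congr rfl fun i _ => by rw [hTdiag]
  -- the Lagrange numerators at `T` are `cᵢ` times integer matrices `A i`
  have hA : ∀ i : Fin n, ∃ A' : Matrix (Fin n) (Fin n) ℤ,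
      aeval T (∏ j ∈ Finset.univ.erase i, (X - C (l j))) = (∏ j ∈ Finset.univ.erase i, (l i - l j)) • A' := by
    intro i
    refine exists_eq_smul_of_dvd fun k m => ?_
    have e : aeval T (∏ j ∈ Finset.univ.erase i, (X - C (l j))) =
        P₀ * aeval N (∏ j ∈ Finset.univ.erase i, (X - C (l j))) * P₀⁻¹ := by
      rw [conj_aeval hP₀N, Matrix.mul_nonsing_inv_cancel_right P₀ _ hP₀]
    obtain ⟨B, hB⟩ := exists_eq_smul_of_dvd (hdvd i)
    rw [e, hB, Matrix.mul_smul, Matrix.smul_mul, Matrix.smul_apply, smul_eq_mul]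
    exact Dvd.intro _ rfl
  choose A hA using hA
  have hc : ∀ i : Fin n, ∏ j ∈ Finset.univ.erase i, (l i - l j) ≠ 0 := lagrange_ne_zero hl
  -- `T · A i = λᵢ · A i`
  have hTA : ∀ i, T * A i = l i • A i := by
    intro i
    have e := sub_mul_aeval_lagrange hTχ i
    rw [hA i, Matrix.mul_smul] at e
    have e' : (T - l i • (1 : Matrix (Fin n) (Fin n) ℤ)) * A i = 0 := (smul_eq_zero.1 e).resolve_left (hc i)
    rwa [sub_mul, sub_eq_zero, smul_mul_assoc, one_mul] at e'
  -- `A i` is upper triangular with diagonal `[k = i]`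
  have hAtri : ∀ i k m : Fin n, m < k → A i k m = 0 := by
    intro i k m hkm
    have e := congr_fun (congr_fun (hA i) k) m
    rw [(aeval_upper hT _).1 hkm, Matrix.smul_apply, smul_eq_mul] at e
    exact (mul_eq_zero.1 e.symm).resolve_left (hc i)
  have hAdiag : ∀ i k : Fin n, A i k k = if k = i then 1 else 0 := by
    intro i k
    have e := congr_fun (congr_fun (hA i) k) k
    rw [(aeval_upper hT _).2 k, hTdiag, eval_lagrange, Matrix.smul_apply, smul_eq_mul] at e
    split_ifs at e ⊢ with hki
    · exact mul_left_cancel₀ (hc i) (by rw [mul_one]; exact e.symm)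
    · exact (mul_eq_zero.1 e.symm).resolve_left (hc i)
  -- the matrix of normalised eigenvector columns
  set V : Matrix (Fin n) (Fin n) ℤ := Matrix.of fun k i => A i k i with hV_def
  have hVtri : V.BlockTriangular id := fun k i hik => by
    rw [hV_def, Matrix.of_apply]; exact hAtri i k i hik
  have hVdet : V.det = 1 := by
    rw [Matrix.det_of_upperTriangular hVtri]
    exact Finset.prod_eq_one fun k _ => by rw [hV_def, Matrix.of_apply, hAdiag, if_pos rfl]
  have hV : IsUnit V.det := by rw [hVdet]; exact isUnit_one
  have hTV : T * V = V * diagonal l := by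
    ext k i
    rw [Matrix.mul_diagonal, Matrix.mul_apply]
    have e := congr_fun (congr_fun (hTA i) k) i
    rw [Matrix.mul_apply, Matrix.smul_apply, smul_eq_mul] at e
    simp only [hV_def, Matrix.of_apply]
    rw [e, mul_comm]
  refine ⟨V⁻¹ * P₀, by rw [det_mul]; exact (Matrix.isUnit_nonsing_inv_det V hV).mul hP₀, ?_⟩
  have hVT : V⁻¹ * T = diagonal l * V⁻¹ := by
    calc V⁻¹ * T = V⁻¹ * T * (V * V⁻¹) := by rw [Matrix.mul_nonsing_inv V hV, Matrix.mul_one]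
      _ = V⁻¹ * (T * V) * V⁻¹ := by simp only [Matrix.mul_assoc]
      _ = V⁻¹ * (V * diagonal l) * V⁻¹ := by rw [hTV]
      _ = diagonal l * V⁻¹ := by rw [← Matrix.mul_assoc, Matrix.nonsing_inv_mul V hV, Matrix.one_mul]
  rw [Matrix.mul_assoc, hP₀N, ← Matrix.mul_assoc, hVT, Matrix.mul_assoc]

/-- **THE CRITERION.**  For `N ∈ Mₙ(ℤ)` with `χ_N = ∏ᵢ (t − λᵢ)`, `λᵢ ∈ ℤ` pairwise different:
`N` is `GLₙ(ℤ)`-conjugate to `diag(λ₁, …, λₙ)` **iff** for every `i` the integer `cᵢ = ∏_{j≠i} (λᵢ − λⱼ)` divides all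
entries of `qᵢ(N) = ∏_{j≠i} (N − λⱼ)`, i.e. iff the Lagrange idempotents `eᵢ(N) = qᵢ(N)/cᵢ` are integer matrices, i.e.
iff the order of the corresponding lattice class is the maximal order `Λ_max = ℤe₁ + ⋯ + ℤeₙ`, whose class number is
`1`. [cite: HertlingLarabi2026b, §9.1 («`Λ_max = ℤe₁ + ... + ℤeₙ` … the class number of `A` is `|G([Λ_max]_ε)| = 1`»), chunk p0027, with §6 Thm. 6.3, chunk p0012] -/
theorem conj_diagonal_iff_dvd_aeval {N : Matrix (Fin n) (Fin n) ℤ} {l : Fin n → ℤ}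
    (hl : Function.Injective l) (h : N.charpoly = ∏ i, (X - C (l i))) :
    (∃ P : Matrix (Fin n) (Fin n) ℤ, IsUnit P.det ∧ P * N = diagonal l * P) ↔
      ∀ i k m : Fin n, (∏ j ∈ Finset.univ.erase i, (l i - l j)) ∣
        (aeval N (∏ j ∈ Finset.univ.erase i, (X - C (l j)))) k m :=
  ⟨fun ⟨_, hP, hPN⟩ i k m => dvd_aeval_of_conj_diagonal hP hPN i k m,
    fun hdvd => exists_conj_diagonal_of_dvd_aeval hl h hdvd⟩

/-! ## §4 The centraliser of `diag(λ)` in `GLₙ(ℤ)`: the `2ⁿ` units `Σ εᵢeᵢ` of `Λ_max` -/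

/-- A matrix commutes with `diag(λ)`, `λ` pairwise different, iff it is diagonal. [folklore; matrix form of
`End_A(A) = A` for `A = ℚe₁ + ⋯ + ℚeₙ`] [cite: HertlingLarabi2026b, §9.1, chunk p0027] -/
theorem comm_diagonal_iff {l : Fin n → ℤ} (hl : Function.Injective l) (P : Matrix (Fin n) (Fin n) ℤ) :
    P * diagonal l = diagonal l * P ↔ ∀ k m, k ≠ m → P k m = 0 := by
  constructor
  · intro h k m hkm
    have e := congr_fun (congr_fun h k) m
    rw [Matrix.mul_diagonal, Matrix.diagonal_mul] at e
    have e' : P k m * (l m - l k) = 0 := by rw [mul_sub, e]; ring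
    exact (mul_eq_zero.1 e').resolve_right (sub_ne_zero.2 fun e => hkm (hl e).symm)
  · intro h
    ext k m
    rw [Matrix.mul_diagonal, Matrix.diagonal_mul]
    by_cases hkm : k = m
    · subst hkm; exact mul_comm _ _
    · rw [h k m hkm, zero_mul, mul_zero]

/-- **The centraliser of `diag(λ₁, …, λₙ)` (pairwise different `λᵢ`) in `GLₙ(ℤ)` consists of the `2ⁿ` diagonal sign
matrices** — the units «`Λ_max^{unit} = {Σᵢ εᵢeᵢ | ε₁, ..., εₙ ∈ {±1}}`» of the maximal order acting on `Λ_max`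
in the basis `e₁, …, eₙ`. [cite: HertlingLarabi2026b, §9.1, chunk p0027, with §6 Thm. 6.3, chunk p0012] -/
theorem isUnit_det_and_comm_diagonal_iff {l : Fin n → ℤ} (hl : Function.Injective l)
    (P : Matrix (Fin n) (Fin n) ℤ) :
    (IsUnit P.det ∧ P * diagonal l = diagonal l * P) ↔
      ∃ ε : Fin n → ℤ, (∀ k, ε k = 1 ∨ ε k = -1) ∧ P = diagonal ε := by
  constructor
  · rintro ⟨hP, hcomm⟩
    have hdiag : P = diagonal fun k => P k k := by
      ext k m
      by_cases hkm : k = m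
      · subst hkm; rw [diagonal_apply_eq]
      · rw [diagonal_apply_ne _ hkm, (comm_diagonal_iff hl P).1 hcomm k m hkm]
    refine ⟨fun k => P k k, fun k => ?_, hdiag⟩
    rw [hdiag, det_diagonal] at hP
    exact Int.isUnit_iff.1 (IsUnit.prod_univ_iff.1 hP k)
  · rintro ⟨ε, hε, rfl⟩
    refine ⟨?_, ?_⟩
    · rw [det_diagonal]
      exact IsUnit.prod_univ_iff.2 fun k => Int.isUnit_iff.2 (hε k)
    · rw [diagonal_mul_diagonal, diagonal_mul_diagonal]
      exact congr_arg _ (funext fun k => mul_comm _ _)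

/-- **`|Λ_max^{unit}| = 2ⁿ`** in matrix form: the centraliser of `diag(λ₁, …, λₙ)` (pairwise different `λᵢ`) in
`GLₙ(ℤ)` has exactly `2ⁿ` elements. [cite: HertlingLarabi2026b, §9.1 («so `|Λ_max^{unit}| = 2ⁿ`»), chunk p0027] -/
theorem natCard_centralizer_diagonal {l : Fin n → ℤ} (hl : Function.Injective l) :
    Nat.card {P : Matrix (Fin n) (Fin n) ℤ // IsUnit P.det ∧ P * diagonal l = diagonal l * P} = 2 ^ n := by
  classical
  -- the bijection with sign vectors `Fin n → ℤˣ`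
  have hdiagP : ∀ P : {P : Matrix (Fin n) (Fin n) ℤ // IsUnit P.det ∧ P * diagonal l = diagonal l * P},
      ∀ k, IsUnit (P.1 k k) := by
    rintro ⟨P, hP⟩ k
    obtain ⟨ε, hε, rfl⟩ := (isUnit_det_and_comm_diagonal_iff hl P).1 hP
    show IsUnit (diagonal ε k k)
    rw [diagonal_apply_eq]
    exact Int.isUnit_iff.2 (hε k)
  let F : {P : Matrix (Fin n) (Fin n) ℤ // IsUnit P.det ∧ P * diagonal l = diagonal l * P} → (Fin n → ℤˣ) :=
    fun P k => (hdiagP P k).unit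
  let G : (Fin n → ℤˣ) → {P : Matrix (Fin n) (Fin n) ℤ // IsUnit P.det ∧ P * diagonal l = diagonal l * P} :=
    fun u => ⟨diagonal fun k => (u k : ℤ), (isUnit_det_and_comm_diagonal_iff hl _).2
      ⟨fun k => (u k : ℤ), fun k => Int.isUnit_iff.1 (u k).isUnit, rfl⟩⟩
  have hGF : ∀ P, G (F P) = P := by
    rintro ⟨P, hP⟩
    obtain ⟨ε, hε, rfl⟩ := (isUnit_det_and_comm_diagonal_iff hl P).1 hP
    refine Subtype.ext (congr_arg diagonal (funext fun k => ?_))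
    change (((hdiagP ⟨diagonal ε, hP⟩ k).unit : ℤˣ) : ℤ) = ε k
    rw [IsUnit.unit_spec]
    show diagonal ε k k = ε k
    rw [diagonal_apply_eq]
  have hFG : ∀ u, F (G u) = u := by
    intro u
    funext k
    refine Units.ext ?_
    change (((hdiagP (G u) k).unit : ℤˣ) : ℤ) = (u k : ℤ)
    rw [IsUnit.unit_spec]
    change (diagonal fun k => (u k : ℤ)) k k = (u k : ℤ)
    rw [diagonal_apply_eq]
  let e : {P : Matrix (Fin n) (Fin n) ℤ // IsUnit P.det ∧ P * diagonal l = diagonal l * P} ≃ (Fin n → ℤˣ) :=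
    ⟨F, G, hGF, hFG⟩
  rw [Nat.card_congr e, Nat.card_eq_fintype_card, Fintype.card_fun, Fintype.card_fin, Fintype.card_units_int]

end Literature.LinearAlgebra.Matrix.IntegerMatrixDiagonalizableOverZ
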